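import Mathlib
import Summits.ResolutionOfSingularities.ResolutionOfSingularities.Theorems.WildQuotientsWildQuotientResolutionJordanThreeOrder

/-!
# Rung V3: every non-trivial element of `⟨J₃⟩` acts by a `J₃`-type law (characteristic 3)

(crux stmt-ResolutionOfSingularities-15640 `WildQuotients.WildQuotientResolution`, line `Sketch`,
sector `|G| = p`; rung V3 of `L/w45c/CHAIN.md` v4, lead-1's one-blow-up model RULING
2026-08-27T01:07:58Z, g-LAW lemma asked of stub-1; [OURS · L1 W4.5c] — NOT a statement of any
manuscript; replaces the role of no printed item.)

For the `J₃` datum `σ x_b = x_b + x_a`, `σ x_c = x_c + x_b`, identity on the other coordinates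
(`a, b, c` distinct) over a field of characteristic `3`, every `1 ≠ g ∈ ⟨σ⟩` is `σʲ` with `3 ∤ j` and
acts by `g x_a = x_a`, `g x_b = x_b + m • x_a`, `g x_c = x_c + m • x_b + q • x_a`, `g xᵢ = xᵢ`
otherwise, with `m = j ≠ 0` and `q = (j choose 2)` in `k` (`exists_law_of_ne_one`; from
`JordanThree.pow_apply_X_b/_c/_of_ne`). This is the form in which the divisorial hypothesis `hdiv`
(quantified over every `g`) consumes the chart identities of `…JordanThreeChartAlgebra`, whose
multiplier is this `m`.
-/

-- single-problem summit: the doubled namespace component `ResolutionOfSingularities` is forced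
set_option linter.dupNamespace false

noncomputable section

open MvPolynomial

namespace Summit.ResolutionOfSingularities.ResolutionOfSingularities.Theorems.WildQuotientResolution.JordanThree

/-- **Every element of `⟨σ⟩` is `σʲ` and acts by the `J₃` law with multiplier `j`** (any
characteristic): `g x_a = x_a`, `g x_b = x_b + j • x_a`, `g x_c = x_c + j • x_b + (j choose 2) • x_a`,
`g xᵢ = xᵢ` for `i ≠ b, c`, provided `σ` has finite order. [folklore] -/
theorem exists_pow_law (k : Type) [Field k] (n : ℕ)
    (σ : MvPolynomial (Fin n) k ≃ₐ[k] MvPolynomial (Fin n) k) (a b c : Fin n)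
    (hab : a ≠ b) (hac : a ≠ c) (hb : σ (X b) = X b + X a) (hc : σ (X c) = X c + X b)
    (hσ : ∀ i, i ≠ b → i ≠ c → σ (X i) = X i) (hfin : IsOfFinOrder σ)
    (g : Subgroup.zpowers σ) :
    ∃ j : ℕ, σ ^ j = (g : MvPolynomial (Fin n) k ≃ₐ[k] MvPolynomial (Fin n) k) ∧
      (g : MvPolynomial (Fin n) k ≃ₐ[k] MvPolynomial (Fin n) k) (X a) = X a ∧
      (g : MvPolynomial (Fin n) k ≃ₐ[k] MvPolynomial (Fin n) k) (X b) = X b + (j : k) • X a ∧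
      (g : MvPolynomial (Fin n) k ≃ₐ[k] MvPolynomial (Fin n) k) (X c) =
        X c + (j : k) • X b + ((j.choose 2 : ℕ) : k) • X a ∧
      ∀ i, i ≠ b → i ≠ c → (g : MvPolynomial (Fin n) k ≃ₐ[k] MvPolynomial (Fin n) k) (X i) = X i := by
  obtain ⟨j, hj⟩ : (g : MvPolynomial (Fin n) k ≃ₐ[k] MvPolynomial (Fin n) k) ∈ Submonoid.powers σ :=
    hfin.mem_powers_iff_mem_zpowers.mpr g.2
  have hj' : σ ^ j = (g : MvPolynomial (Fin n) k ≃ₐ[k] MvPolynomial (Fin n) k) := hj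
  refine ⟨j, hj', ?_, ?_, ?_, ?_⟩
  · rw [← hj']
    exact pow_apply_X_of_ne k n σ b c hσ j a hab hac
  · rw [← hj', pow_apply_X_b k n σ a b c hab hac hb hσ j, MvPolynomial.smul_eq_C_mul, map_natCast]
  · rw [← hj', pow_apply_X_c k n σ a b c hab hac hb hc hσ j, MvPolynomial.smul_eq_C_mul,
      MvPolynomial.smul_eq_C_mul, map_natCast, map_natCast]
  · intro i hib hic
    rw [← hj']
    exact pow_apply_X_of_ne k n σ b c hσ j i hib hic

/-- **The g-LAW lemma** (lead-1's V3 one-blow-up model, RULING 2026-08-27T01:07:58Z): over a field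
of characteristic `3`, every `1 ≠ g ∈ ⟨σ⟩` acts by `g x_a = x_a`, `g x_b = x_b + m • x_a`,
`g x_c = x_c + m • x_b + q • x_a`, `g xᵢ = xᵢ` (`i ≠ b, c`) with `m ≠ 0` (`g = σʲ`, `3 ∤ j`,
`m = j`, `q = (j choose 2)`). [folklore] -/
theorem exists_law_of_ne_one (k : Type) [Field k] [CharP k 3] (n : ℕ)
    (σ : MvPolynomial (Fin n) k ≃ₐ[k] MvPolynomial (Fin n) k) (a b c : Fin n)
    (hab : a ≠ b) (hac : a ≠ c) (hb : σ (X b) = X b + X a) (hc : σ (X c) = X c + X b)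
    (hσ : ∀ i, i ≠ b → i ≠ c → σ (X i) = X i)
    (g : Subgroup.zpowers σ) (hg : g ≠ 1) :
    ∃ m q : k, m ≠ 0 ∧
      (g : MvPolynomial (Fin n) k ≃ₐ[k] MvPolynomial (Fin n) k) (X a) = X a ∧
      (g : MvPolynomial (Fin n) k ≃ₐ[k] MvPolynomial (Fin n) k) (X b) = X b + m • X a ∧
      (g : MvPolynomial (Fin n) k ≃ₐ[k] MvPolynomial (Fin n) k) (X c) = X c + m • X b + q • X a ∧
      ∀ i, i ≠ b → i ≠ c → (g : MvPolynomial (Fin n) k ≃ₐ[k] MvPolynomial (Fin n) k) (X i) = X i := by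
  have hσ3 : σ ^ 3 = 1 := pow_three_eq_one k n σ a b c hab hac hb hc hσ
  have hfin : IsOfFinOrder σ := isOfFinOrder_iff_pow_eq_one.mpr ⟨3, by norm_num, hσ3⟩
  obtain ⟨j, hj, hga, hgb, hgc, hgi⟩ := exists_pow_law k n σ a b c hab hac hb hc hσ hfin g
  have hndvd : ¬ 3 ∣ j := by
    rintro ⟨l, rfl⟩
    apply hg
    apply Subtype.ext
    change (g : MvPolynomial (Fin n) k ≃ₐ[k] MvPolynomial (Fin n) k) = 1
    rw [← hj, pow_mul, hσ3, one_pow]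
  have hmk : (j : k) ≠ 0 := fun h => hndvd ((CharP.cast_eq_zero_iff k 3 j).mp h)
  exact ⟨(j : k), ((j.choose 2 : ℕ) : k), hmk, hga, hgb, hgc, hgi⟩

/-- The multiplier law in the `MvPolynomial`-native form (`C m * x` instead of `m • x`), for
rewriting inside ring computations. [folklore] -/
theorem exists_law_of_ne_one' (k : Type) [Field k] [CharP k 3] (n : ℕ)
    (σ : MvPolynomial (Fin n) k ≃ₐ[k] MvPolynomial (Fin n) k) (a b c : Fin n)
    (hab : a ≠ b) (hac : a ≠ c) (hb : σ (X b) = X b + X a) (hc : σ (X c) = X c + X b)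
    (hσ : ∀ i, i ≠ b → i ≠ c → σ (X i) = X i)
    (g : Subgroup.zpowers σ) (hg : g ≠ 1) :
    ∃ m q : k, m ≠ 0 ∧
      (g : MvPolynomial (Fin n) k ≃ₐ[k] MvPolynomial (Fin n) k) (X a) = X a ∧
      (g : MvPolynomial (Fin n) k ≃ₐ[k] MvPolynomial (Fin n) k) (X b) = X b + C m * X a ∧
      (g : MvPolynomial (Fin n) k ≃ₐ[k] MvPolynomial (Fin n) k) (X c) =
        X c + C m * X b + C q * X a ∧
      ∀ i, i ≠ b → i ≠ c → (g : MvPolynomial (Fin n) k ≃ₐ[k] MvPolynomial (Fin n) k) (X i) = X i := by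
  obtain ⟨m, q, hm, hga, hgb, hgc, hgi⟩ := exists_law_of_ne_one k n σ a b c hab hac hb hc hσ g hg
  refine ⟨m, q, hm, hga, ?_, ?_, hgi⟩
  · rw [hgb, MvPolynomial.smul_eq_C_mul]
  · rw [hgc, MvPolynomial.smul_eq_C_mul, MvPolynomial.smul_eq_C_mul]

end Summit.ResolutionOfSingularities.ResolutionOfSingularities.Theorems.WildQuotientResolution.JordanThree

end
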